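import Summits.NavierStokesRegularity.FluidComputer.PalasekTowerLiveClassAt
import Literature.Analysis.FluidPDE.BackwardEnergyUniqueness
import Literature.Analysis.FluidPDE.IsometryInvariance
import Literature.Analysis.FluidPDE.AxisymmetricReflection
import Literature.Analysis.FluidPDE.ClassicalSolutionRescale

/-!
# DEAD SLICES PROPAGATE BACKWARD along decaying unforced classical flows: a live datum stays live
# (the analytic content of stub S3 `LiveDatumPropagatesT` of the robust-mirror line, by kernel, from tree theorems)

Cell `ns-blowup`, seat `ns-blowup-refuter4` (g10, K221; ledger refuter of record for route `PalasekTowerBreakdown` rev 19, cruxes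
stmt-NavierStokesRegularity-20304 `HeredityAtOneT` / -20305 `HeredityFromTwoT`; live-class repair `LiveStageAt` /
`DeadSlice` of `FluidComputer/PalasekTowerLiveClassAt`; cstrat-19179's line «robustmirror», stub S3 `stub_live_datum_propagatesT`:
"if the datum of an unforced tuned design is not a dead slice, then no registered stage of it has a dead readout slice").
Negative-lane SUPPORT (`--supports 20304`), no Theses import, no definition, no named fact.

The docstring of S3 names the argument: a dead slice at the final time is, in some rigid placement `(A, b)`, axisymmetric AND
swirl-free, i.e. fixed by conjugation with every rotation `R_θ` about the axis and with the meridian reflection `σ`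
(`isAxisymmetric_iff_conj_rotZLIE`, `IsAxisymmetric.conj_reflY_eq`); rigid motions carry classical solutions of the free
system to classical solutions (`IsClassicalNSSolutionOn.conj_linearIsometryEquiv`, `.spaceTranslate`) and preserve uniform
rapid decay; two decaying classical solutions of the free system on `[0, T]` that agree at `T` agree on `[0, T]`
(`IsClassicalNSSolutionOn.backward_unique`, Temam 1997 Ch. III §6 after Bardos–Tartar 1973); so the datum is fixed by the
same conjugations, hence axisymmetric and swirl-free in the same placement (`IsAxisymmetric.hasNoSwirl_of_conj_reflY_eq`),
hence dead. Every ingredient is a theorem of the tree; this file is the ≈ 100-line composition: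

* `hasUniformRapidDecayOn_spaceShift` — uniform rapid decay on a time set `S` is invariant under `x ↦ a + x`
  (constants `(1 + ‖a‖)^K C`; sibling of `HasRapidSpaceTimeDecay.spaceShift`);
* `conj_eq_initial_of_conj_eq_final` — BACKWARD symmetry propagation: a linear isometry fixing the final slice of a
  decaying unforced classical flow fixes every slice on `[0, T]`;
* `deadSlice_initial_of_deadSlice_final` — `DeadSlice (u T) → DeadSlice (u 0)`;
* `not_deadSlice_final_of_not_deadSlice_initial` — the contrapositive, the shape S3 consumes: `¬ DeadSlice (u 0) →
  ¬ DeadSlice (u T)`.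

What S3 still needs beyond this file (information for cstrat / the prover): the registered stage must hand over (i) the
classical solution of the FREE system on `[0, τ_k]` from `S.u₀` and (ii) its uniform rapid decay `HasUniformRapidDecayOn
(Icc 0 τ_k)` (a `Stage` carries bounded energy and smoothness; if it does not carry (ii), S3 needs the decay-persistence
theorem for Schwartz data, or a `backward_unique` in the bounded-energy class — ESŠ 2003 — which the tree does not hold).

WHAT THIS IS NOT: not NS regularity or blow-up — a composition of rigid covariance and the tree's log-convexity backward
uniqueness; nothing about any stage, register, run or certificate; 20304/20305 stay OPEN.
-/

noncomputable section

namespace Summit.NavierStokesRegularity.HeredityAtOneTDeadSliceBackward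

open Set Function
open scoped Pointwise
open Literature.Analysis.FluidPDE
open Summit.NavierStokesRegularity.FluidComputer.PalasekTowerClayBridge

/-! ## Uniform rapid decay under a space shift -/

/-- The polynomial weight under a translation: `1 + ‖x‖ ≤ (1 + ‖a‖) (1 + ‖a + x‖)`. [folklore] -/
private theorem one_add_norm_le_mul_shift (a x : EuclideanSpace ℝ (Fin 3)) :
    1 + ‖x‖ ≤ (1 + ‖a‖) * (1 + ‖a + x‖) := by
  have h1 : ‖x‖ ≤ ‖a‖ + ‖a + x‖ := by
    have := norm_sub_le (a + x) a
    simpa [add_sub_cancel_left, add_comm] using this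
  nlinarith [norm_nonneg a, norm_nonneg (a + x)]

/-- Translating the slab `S × ℝ³` by `(0, a)` gives it back. [folklore] -/
private theorem vadd_zero_prod_univ (S : Set ℝ) (a : EuclideanSpace ℝ (Fin 3)) :
    (((0 : ℝ), a) : ℝ × EuclideanSpace ℝ (Fin 3)) +ᵥ (S ×ˢ (univ : Set (EuclideanSpace ℝ (Fin 3)))) =
      S ×ˢ (univ : Set (EuclideanSpace ℝ (Fin 3))) := by
  ext z
  simp only [Set.mem_vadd_set, mem_prod, mem_univ, and_true]
  constructor
  · rintro ⟨y, hy, rfl⟩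
    simpa using hy
  · intro hz
    exact ⟨(z.1, z.2 - a), by simpa using hz, by ext <;> simp⟩

/-- The space–time derivatives of the shifted field within the slab are those of the field at the shifted point
(Mathlib `iteratedFDerivWithin_comp_add_left`; the translation by `(0, a)` fixes the slab). [folklore] -/
private theorem iteratedFDerivWithin_spaceShift (S : Set ℝ)
    (u : ℝ → EuclideanSpace ℝ (Fin 3) → EuclideanSpace ℝ (Fin 3)) (a : EuclideanSpace ℝ (Fin 3)) (n : ℕ) (t : ℝ)
    (x : EuclideanSpace ℝ (Fin 3)) :
    iteratedFDerivWithin ℝ n (uncurry fun s y => u s (a + y)) (S ×ˢ univ) (t, x) =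
      iteratedFDerivWithin ℝ n (uncurry u) (S ×ˢ univ) (t, a + x) := by
  have he : uncurry (fun s y => u s (a + y)) =
      fun z : ℝ × EuclideanSpace ℝ (Fin 3) => uncurry u ((((0 : ℝ), a) : ℝ × EuclideanSpace ℝ (Fin 3)) + z) := by
    funext z; obtain ⟨s, y⟩ := z; simp
  rw [he, iteratedFDerivWithin_comp_add_left, vadd_zero_prod_univ]
  have hpt : ((((0 : ℝ), a) : ℝ × EuclideanSpace ℝ (Fin 3)) + (t, x)) = (t, a + x) := by ext <;> simp
  rw [hpt]

/-- **Uniform rapid decay is invariant under space shifts**: if `(1 + ‖x‖)^K ‖Dⁿ u (t, x)‖ ≤ C_{n,K}` on `S × ℝ³`, then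
`(t, x) ↦ u t (a + x)` obeys the same bounds with constants `(1 + ‖a‖)^K C_{n,K}`. [folklore] -/
theorem hasUniformRapidDecayOn_spaceShift {S : Set ℝ} {u : ℝ → EuclideanSpace ℝ (Fin 3) → EuclideanSpace ℝ (Fin 3)}
    (hd : HasUniformRapidDecayOn S u) (a : EuclideanSpace ℝ (Fin 3)) :
    HasUniformRapidDecayOn S (fun t x => u t (a + x)) := by
  intro n K
  obtain ⟨C, hC⟩ := hd n K
  refine ⟨(1 + ‖a‖) ^ K * C, fun t ht x => ?_⟩
  rw [iteratedFDerivWithin_spaceShift]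
  have hC0 : 0 ≤ C := le_trans (by positivity) (hC t ht (a + x))
  have hw : (1 + ‖x‖) ^ K ≤ (1 + ‖a‖) ^ K * (1 + ‖a + x‖) ^ K := by
    rw [← mul_pow]
    exact pow_le_pow_left₀ (by positivity) (one_add_norm_le_mul_shift a x) K
  calc (1 + ‖x‖) ^ K * ‖iteratedFDerivWithin ℝ n (uncurry u) (S ×ˢ univ) (t, a + x)‖
      ≤ (1 + ‖a‖) ^ K * (1 + ‖a + x‖) ^ K * ‖iteratedFDerivWithin ℝ n (uncurry u) (S ×ˢ univ) (t, a + x)‖ :=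
        mul_le_mul_of_nonneg_right hw (norm_nonneg _)
    _ = (1 + ‖a‖) ^ K * ((1 + ‖a + x‖) ^ K * ‖iteratedFDerivWithin ℝ n (uncurry u) (S ×ˢ univ) (t, a + x)‖) := by
        ring
    _ ≤ (1 + ‖a‖) ^ K * C := mul_le_mul_of_nonneg_left (hC t ht (a + x)) (by positivity)

/-! ## Backward propagation of rigid symmetries -/

/-- **A linear isometry fixing the FINAL slice of a decaying unforced classical flow fixes every slice** (rigid covariance
`IsClassicalNSSolutionOn.conj_linearIsometryEquiv` + backward uniqueness `IsClassicalNSSolutionOn.backward_unique`; the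
backward twin of `IsClassicalNSSolutionOn.conj_eq_of_forced`). [cite: Temam1997, Ch. III §6.2 with Lemma 6.2 (pp. 172–175)] -/
theorem conj_eq_initial_of_conj_eq_final {T ν : ℝ} (hT : 0 < T) (hν : 0 < ν)
    (R : EuclideanSpace ℝ (Fin 3) ≃ₗᵢ[ℝ] EuclideanSpace ℝ (Fin 3))
    {u : ℝ → EuclideanSpace ℝ (Fin 3) → EuclideanSpace ℝ (Fin 3)} {p : ℝ → EuclideanSpace ℝ (Fin 3) → ℝ}
    (hu : IsClassicalNSSolutionOn (Icc 0 T) ν 0 u p) (hd : HasUniformRapidDecayOn (Icc 0 T) u)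
    (hfix : ∀ x, R (u T (R.symm x)) = u T x) :
    ∀ t ∈ Icc 0 T, ∀ x, R (u t (R.symm x)) = u t x := by
  have hS : UniqueDiffOn ℝ (Icc 0 T) := uniqueDiffOn_Icc hT
  have hv : IsClassicalNSSolutionOn (Icc 0 T) ν 0 (fun s y => R (u s (R.symm y))) (fun s y => p s (R.symm y)) :=
    (hu.conj_linearIsometryEquiv R hS).congr_force fun s _ y => by simp
  have hvd : HasUniformRapidDecayOn (Icc 0 T) (fun s y => R (u s (R.symm y))) := hd.conj_linearIsometryEquiv R hS
  have hfin : (fun s y => R (u s (R.symm y))) T = u T := funext hfix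
  intro t ht x
  exact congrFun (IsClassicalNSSolutionOn.backward_unique hT hν hv hu hvd hd hfin t ht) x

/-- The conjugate of a decaying unforced classical flow by a rigid placement `x ↦ A⁻¹ (u (A x + b))` is again a decaying
unforced classical flow (`spaceTranslate` by `b`, then `conj_linearIsometryEquiv` by `A⁻¹`). [folklore] -/
theorem conjSlice_flow {T ν : ℝ} (hT : 0 < T) (A : EuclideanSpace ℝ (Fin 3) ≃ₗᵢ[ℝ] EuclideanSpace ℝ (Fin 3))
    (b : EuclideanSpace ℝ (Fin 3))
    {u : ℝ → EuclideanSpace ℝ (Fin 3) → EuclideanSpace ℝ (Fin 3)} {p : ℝ → EuclideanSpace ℝ (Fin 3) → ℝ}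
    (hu : IsClassicalNSSolutionOn (Icc 0 T) ν 0 u p) (hd : HasUniformRapidDecayOn (Icc 0 T) u) :
    IsClassicalNSSolutionOn (Icc 0 T) ν 0 (fun t => conjSlice A b (u t)) (fun t x => p t (b + A x)) ∧
      HasUniformRapidDecayOn (Icc 0 T) (fun t => conjSlice A b (u t)) := by
  have hS : UniqueDiffOn ℝ (Icc 0 T) := uniqueDiffOn_Icc hT
  -- translate by `b`
  have h1 : IsClassicalNSSolutionOn (Icc 0 T) ν 0 (fun t x => u t (b + x)) (fun t x => p t (b + x)) :=
    (hu.spaceTranslate b).congr_force fun s _ y => by simp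
  have h1d : HasUniformRapidDecayOn (Icc 0 T) (fun t x => u t (b + x)) := hasUniformRapidDecayOn_spaceShift hd b
  -- conjugate by `A⁻¹`
  have h2 := (h1.conj_linearIsometryEquiv A.symm hS).congr_force (g := 0) fun s _ y => by simp
  have h2d := h1d.conj_linearIsometryEquiv A.symm hS
  have he : (fun t x => A.symm ((fun t x => u t (b + x)) t (A.symm.symm x))) = fun t => conjSlice A b (u t) := by
    funext t x; simp [conjSlice, add_comm]
  have hp : (fun t x => (fun t x => p t (b + x)) t (A.symm.symm x)) = fun t x => p t (b + A x) := by
    funext t x; simp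
  rw [he, hp] at h2
  rw [he] at h2d
  exact ⟨h2, h2d⟩

/-- **A dead final slice comes from a dead datum**: if a decaying unforced classical flow on `[0, T] × ℝ³` is, at time `T`,
axisymmetric AND swirl-free in some rigid placement, then so is its datum, in the same placement.
[cite: Temam1997, Ch. III §6.2 with Lemma 6.2 (pp. 172–175)] -/
theorem deadSlice_initial_of_deadSlice_final {T ν : ℝ} (hT : 0 < T) (hν : 0 < ν)
    {u : ℝ → EuclideanSpace ℝ (Fin 3) → EuclideanSpace ℝ (Fin 3)} {p : ℝ → EuclideanSpace ℝ (Fin 3) → ℝ}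
    (hu : IsClassicalNSSolutionOn (Icc 0 T) ν 0 u p) (hd : HasUniformRapidDecayOn (Icc 0 T) u)
    (hdead : DeadSlice (u T)) : DeadSlice (u 0) := by
  obtain ⟨A, b, hax, hsw⟩ := hdead
  obtain ⟨hv, hvd⟩ := conjSlice_flow hT A b hu hd
  set v : ℝ → EuclideanSpace ℝ (Fin 3) → EuclideanSpace ℝ (Fin 3) := fun t => conjSlice A b (u t)
  have h00 : (0 : ℝ) ∈ Icc 0 T := ⟨le_rfl, hT.le⟩
  -- rotations about the axis fix `v T`, hence `v 0`
  have hrot : ∀ θ x, rotZLIE θ (v 0 ((rotZLIE θ).symm x)) = v 0 x := fun θ =>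
    conj_eq_initial_of_conj_eq_final hT hν (rotZLIE θ) hv hvd ((isAxisymmetric_iff_conj_rotZLIE (v T)).1 hax θ) 0 h00
  have hax0 : IsAxisymmetric (v 0) := (isAxisymmetric_iff_conj_rotZLIE (v 0)).2 hrot
  -- the meridian reflection fixes `v T`, hence `v 0`
  have hrefl : ∀ x, reflY (v 0 (reflY.symm x)) = v 0 x :=
    conj_eq_initial_of_conj_eq_final hT hν reflY hv hvd (fun x => hax.conj_reflY_eq hsw x) 0 h00
  have hsw0 : HasNoSwirl (v 0) := hax0.hasNoSwirl_of_conj_reflY_eq hrefl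
  exact ⟨A, b, hax0, hsw0⟩

/-- **A live datum stays live** (the shape stub S3 `LiveDatumPropagatesT` consumes): if the datum of a decaying unforced
classical flow on `[0, T] × ℝ³` is not a dead slice, then neither is its slice at time `T`. [cite: Temam1997, Ch. III §6.2 with Lemma 6.2 (pp. 172–175)] -/
theorem not_deadSlice_final_of_not_deadSlice_initial {T ν : ℝ} (hT : 0 < T) (hν : 0 < ν)
    {u : ℝ → EuclideanSpace ℝ (Fin 3) → EuclideanSpace ℝ (Fin 3)} {p : ℝ → EuclideanSpace ℝ (Fin 3) → ℝ}
    (hu : IsClassicalNSSolutionOn (Icc 0 T) ν 0 u p) (hd : HasUniformRapidDecayOn (Icc 0 T) u)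
    (hlive : ¬ DeadSlice (u 0)) : ¬ DeadSlice (u T) :=
  fun h => hlive (deadSlice_initial_of_deadSlice_final hT hν hu hd h)

end Summit.NavierStokesRegularity.HeredityAtOneTDeadSliceBackward

end
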